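import Literature.MathematicalPhysics.QuantumFieldTheory.Balaban1983to89.B9Eq326G1kDivergenceRowClosed
import Literature.MathematicalPhysics.QuantumFieldTheory.Balaban1983to89.B9Eq347GlobalFromLocal

/-!
# `Balaban1983to89.B9Eq347G1kDivergenceGlobal` — T. Bałaban, *Propagators for lattice gauge theories in a background field*, Commun. Math. Phys. **99** (1985)
# 389–434 [Balaban1985BackgroundPropagators] Thm 3.1 (3.47) p. 398 (*«the global inequalities are consequences of the local ones (3.42) and Lemma 2.1»*), Thm 3.3
# p. 399 (*«with G′(U) replaced by G(U)»*), (3.8) p. 392, with [Balaban1985Variational] (117) p. 295: **THE GLOBAL `L^∞ → L^∞` BOUND OF THE DIVERGENCE OF THE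
# TOWER BOND PROPAGATOR, ONE HEIGHT-FREE CONSTANT — `∃ α₁ B` BEFORE `∀ n η c₀ c₁ m U`: for EVERY bond field `f` with `‖f‖_∞ ≤ M` and every fine site `y`,
# `‖(D*_U G₁,k(U) f)(y)‖ ≤ B·M`** — this lineage's (DGK) `B9Eq326G1kDivergenceRowClosed.exists_divergence_row_G1k` (the local, `∃`-first divergence row) summed over
# the source blocks by this lineage's (G) `B9Eq347GlobalFromLocal.norm_apply_le_of_local` with the VOLUME-FREE row constant `K_d(δ)` of `B4Sect5Torus.torusSum_le`; the
# divergence twin of the OWNER t4-ne9-p1 g96's (E3) `B9Eq347G1kSupGradGlobal.exists_global_supGrad_G1k` (value + gradient members), whose plumbing this file follows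
# (credited) — together the three `L^∞` letters the (117) VALUE member asks of `G₁,k`

statement-level skeleton of published theorems with citation tags; proofs where landed; nothing here is a claim about the Yang–Mills mass gap

CITATION HEADER (lean-in-tree rule).  Audit cell `pub-balaban`, sub-cell `t4`, BINDER row NE9; filed by NE9 crux-team LEAF PROVER 03 (`b2b-balaban-t4-ne9-formalise-leaf-03`,
gen 79; road ΔA-CT).  Imports (DGK) and (G) (both this lineage).  SOURCE READ first-hand [Balaban1985BackgroundPropagators] (`paper:balaban1985-cmp99-background-propagators`,
journal page = PDF page + 388): p. 398 Thm 3.1 (3.47) and l. 19–20; p. 399 Thm 3.3; p. 392 (3.8); [Balaban1985Variational] p. 295 (117); [Balaban1984PropagatorsII]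
p. 234 Lemma 2.1 (2.61).  [folklore] summation BY NAME; nothing of print's proofs reproduced.

WHAT IS PROVED (sorry-free; proof lane — no `def`).  **`exists_global_div_G1k`** — `∃ α₁ B, 0 < α₁ ∧ 0 ≤ B ∧ ∀ ⟨(DGK)'s ∀-block up to `hpos`⟩ (f) (M) (0 ≤ M)
(‖f(b)‖ ≤ M) (y), ‖(D*_U(G₁,kf))(y)‖ ≤ B·M`, `B = B_D·K_d(δ_D)`.
HONEST SCOPE.  Summation over one supplier; a theorem about the cell's MODEL; `hpos′`, `hpos` displayed; nothing of [B9] Thm 3.1∕3.3∕3.11 asserted, valued or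
discharged.  NOT NE9 (cell pub-balaban: NE9 NOT PRINTED ∕ NOT PROVED; «NE9 ⇐ the named binders»; row WALLED ON A MODEL (O-NE9-1; #5 UNRULED); spine PROVED 0∕9;
rung (B)+1 on a finite T⁴ — NOT infinite volume, NOT mass gap, NOT BetaPertH, NOT Clay; HONEST DEPENDENCY: continuum YM on T⁴ ⇐ BetaPertH ∧ nine spine estimates
(0/9 proved); BetaPertH ⇐ (D1) ∧ (D4) ∧ CAP+tail; G-an2-4 gates asym, D1 and NE2/3/4).  NEW file; nothing modified.  Net new unproved facts: 0.
-/

noncomputable section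

set_option autoImplicit false

open scoped InnerProductSpace ComplexConjugate BigOperators

namespace Literature.MathematicalPhysics.QuantumFieldTheory.Balaban1983to89.B9Eq347G1kDivergenceGlobal

open B4Sect5Torus (TSite tdist torusSum_le)
open B4Sect5Proof (latticeConst latticeConst_nonneg)
open B9SectCLatticeCarrier (Bond bpos unshift)
open B9Eq311L2Pairing (WL2)
open B9Eq319QprimeTorus (fineP blockCoord)
open B7Prop1Explicit (U1 Wcx boxVec)
open B11Eq103H1Complex (SiteL2K BondL2K covDivL2K)
open B9Eq310DeltaPrime (plaqHolU)
open B9Eq310HessianOperator (adTransportW)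
open B9Eq315QTorus (perCfg cornerSite)
open B9Eq315QTower (towerP UlevOf)
open B9Eq316TowerFlatIsOneStep (towerP_eq_fineP_pow siteCast)
open B9Eq326OperatorTower (QkW laplaceAk G1k)
open B9Eq324DeltaPrimeATower (laplacePrimeAk)
open B9Eq326G1kDivergenceRowClosed (exists_divergence_row_G1k)
open B9Eq347GlobalFromLocal (norm_apply_le_of_local)

variable {d : ℕ} (hd : 1 ≤ d) (L : ℕ) [NeZero L] (hL : 1 ≤ L) (hL3 : 3 ≤ L)
  {𝔸 : Type*} [NormedRing 𝔸] [NormedAlgebra ℂ 𝔸] [CompleteSpace 𝔸] [NormOneClass 𝔸] [StarRing 𝔸] [NormedStarGroup 𝔸] [StarModule ℂ 𝔸]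
  {W : Type*} [NormedAddCommGroup W] [InnerProductSpace ℂ W] [FiniteDimensional ℂ W] (φ : W ≃ₗ[ℂ] 𝔸)
  {Mφ Mφ' : ℝ} (hMφ : 0 ≤ Mφ) (hMφ' : 0 ≤ Mφ') (hφ : ∀ w, ‖φ w‖ ≤ Mφ * ‖w‖) (hφ' : ∀ X, ‖φ.symm X‖ ≤ Mφ' * ‖X‖) (hstar : ∀ X : 𝔸, ‖star X‖ ≤ ‖X‖)
  {a : ℝ} (ha : 0 < a) {a' : ℝ} (ha' : 0 < a') {ϱ : ℝ} (hϱ0 : 0 ≤ ϱ) (hϱ1 : ϱ < 1)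
  (τ : 𝔸 →ₗ[ℂ] ℂ) {Cτ : ℝ} (hτ : ∀ X, ‖τ X‖ ≤ Cτ * ‖X‖) (hCτ : 0 ≤ Cτ) {Mτ : ℝ} (hτm : ∀ X Y : 𝔸, ‖τ (X * Y)‖ ≤ Mτ * ‖X‖ * ‖Y‖) (hMτ : 0 ≤ Mτ)
  {ρw : ℝ} (hρw : 0 ≤ ρw)
  (hτ₁ : ∀ X : 𝔸, τ (star X) = conj (τ X)) (hτ₂ : ∀ X Y : 𝔸, τ (X * Y) = τ (Y * X)) (hφτ : ∀ X Y : 𝔸, ⟪φ.symm X, φ.symm Y⟫_ℂ = τ (star X * Y))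
  (AQ : ℝ)

include hd hL hL3 hMφ hMφ' hφ hφ' hstar ha ha' hϱ0 hϱ1 hτ hCτ hτm hMτ hρw hτ₁ hτ₂ hφτ in
/-- **THE GLOBAL SUP → SUP BOUND OF `D*_UG₁,k`, ONE HEIGHT-FREE CONSTANT** ((3.47) from (3.42) «and Lemma 2.1» for the divergence of print's `G` at the tower's
top level).  For every height, spacing on the diagonal, period, background of the MODEL letters in the window `α ≤ α₁`, ANY positivity witnesses, EVERY bond field
`f` with `‖f‖_∞ ≤ M` and every fine site `y`: `‖(D*_U(G₁,kf))(y)‖ ≤ B·M`. [cite: Balaban1985BackgroundPropagators, Thm 3.1 (3.47) p.398, (3.42) p.397, Thm 3.3 p.399,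
(3.8) p.392; Balaban1985Variational, (117) p.295] [cite: Balaban1984PropagatorsII, Lemma 2.1 (2.61) p.234] -/
theorem exists_global_div_G1k :
    ∃ α₁ B : ℝ, 0 < α₁ ∧ 0 ≤ B ∧
      ∀ (n : ℕ) (η : ℝ) (_hηL : η * (L : ℝ) ^ (n + 1) = 1) (c₀ c₁ : ℝ) [Fact (0 < c₀)] [Fact (0 < c₁)]
        (_hw : c₀ * ((L : ℝ) ^ (n + 1)) ^ d = c₁) (_hρ : |η| ^ d / c₀ ≤ ρw) (m : Fin d → ℕ) [∀ i, NeZero (m i)] (_hm : ∀ i, 1 ≤ m i)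
        (U : Bond d (towerP L m (n + 1)) → 𝔸ˣ) (αU : ℕ → ℝ) (_hα0 : ∀ j, 0 ≤ αU j) (hα1 : ∀ j, αU j ≤ 1 / 64)
        (hU1 : ∀ (j : ℕ) (x : B7Prop1Explicit.Site d) (k : Fin d), perCfg (towerP L m (j + 1)) (UlevOf L m (n + 1) U j) x k ∈ U1 𝔸)
        (hreg : ∀ (j : ℕ) (y : TSite d (towerP L m j)) (k : Fin d) (ρ' : Fin d → Fin L),
          ‖((Wcx L (perCfg (towerP L m (j + 1)) (UlevOf L m (n + 1) U j)) (cornerSite L y) k (boxVec L ρ') : 𝔸ˣ) : 𝔸) - 1‖ ≤ αU j)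
        (εU : ℕ → ℝ) (_hεU : ∀ j, 0 ≤ εU j) (_hUε : ∀ (j : ℕ) (b : Bond d (towerP L m (j + 1))), ‖(UlevOf L m (n + 1) U j b : 𝔸) - 1‖ ≤ εU j)
        (_hLb : ∀ (j : ℕ) (b : Bond d (towerP L m (j + 1))), UlevOf L m (n + 1) U j b ∈ U1 𝔸)
        (α : ℝ) (_hα : 0 ≤ α) (_hαle : α ≤ α₁)
        (hUst : ∀ b, star (U b : 𝔸) = (((U b)⁻¹ : 𝔸ˣ) : 𝔸)) (_hUb : ∀ b, U b ∈ U1 𝔸) (_hUη : ∀ b, ‖(U b : 𝔸) - 1‖ ≤ α * η)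
        (_hpl : ∀ p : B9SectCLatticeCarrier.Plaq d (towerP L m (n + 1)), ‖(plaqHolU U p : 𝔸) - 1‖ ≤ α * η ^ 2)
        (_hUgrad : ∀ (x : TSite d (towerP L m (n + 1))) (μ : Fin d), ‖(U (x, μ) : 𝔸) - U (unshift μ x, μ)‖ ≤ α * η ^ 2)
        (_hRlev : ∀ (j : ℕ) (b : Bond d (towerP L m (j + 1))) (w : W), ‖adTransportW φ (UlevOf L m (n + 1) U j) b w‖ ≤ ‖w‖)
        (_hεg : ∀ j < n + 1, εU j ≤ α * ϱ ^ j) (_hAQ : ∑ j ∈ Finset.range (n + 1), αU j ≤ AQ)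
        (hpos' : ∀ x : SiteL2K ℂ d (towerP L m (n + 1)) c₀ W, x ≠ 0 → 0 < RCLike.re ⟪x, laplacePrimeAk L m n φ η U a' (c₁ := c₁) x⟫_ℂ)
        (hpos : ∀ x : BondL2K ℂ d (towerP L m (n + 1)) c₀ W, x ≠ 0 →
          0 < RCLike.re ⟪x, laplaceAk L m n φ η U hL αU hα1 hU1 hreg τ (c₀ := c₀) (c₁ := c₁) a x⟫_ℂ)
        (f : BondL2K ℂ d (towerP L m (n + 1)) c₀ W) (M : ℝ) (_hM : 0 ≤ M) (_hfM : ∀ b, ‖WL2.equiv ℂ (fun _ : Bond d (towerP L m (n + 1)) => c₀) W f b‖ ≤ M)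
        (y : TSite d (towerP L m (n + 1))),
        ‖WL2.equiv ℂ (fun _ : TSite d (towerP L m (n + 1)) => c₀) W (covDivL2K ℂ c₀ ((η : ℂ))⁻¹ (adTransportW φ fun bb => (U bb)⁻¹)
            (G1k L m n φ η U hL αU hα1 hU1 hreg τ (c₀ := c₀) (c₁ := c₁) hpos f)) y‖ ≤ B * M := by
  classical
  obtain ⟨αD, BD, δD, hαD, hBD, hδD, HD⟩ := exists_divergence_row_G1k hd L hL hL3 φ hMφ hMφ' hφ hφ' hstar ha ha' hϱ0 hϱ1 τ hτ hCτ hτm hMτ hρw hτ₁ hτ₂ hφτ AQ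
  have hKD : 0 ≤ latticeConst d δD := latticeConst_nonneg d hδD.le
  refine ⟨αD, BD * latticeConst d δD, hαD, by positivity, ?_⟩
  intro n η hηL c₀ c₁ _ _ hw hρ m _ hm U αU hα0 hα1 hU1 hreg εU hεU hUε hLb α hα hαle hUst hUb hUη hpl hUgrad hRlev hεg hAQ hpos' hpos f M hM0 hfM y
  -- the divergence of the propagator read on the plain functions (bonds → sites)
  obtain ⟨TD, hTD⟩ : ∃ T : (Bond d (towerP L m (n + 1)) → W) →ₗ[ℂ] (TSite d (towerP L m (n + 1)) → W),
      ∀ g x, T g x = WL2.equiv ℂ (fun _ : TSite d (towerP L m (n + 1)) => c₀) W (covDivL2K ℂ c₀ ((η : ℂ))⁻¹ (adTransportW φ fun bb => (U bb)⁻¹)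
        ((G1k L m n φ η U hL αU hα1 hU1 hreg τ (c₀ := c₀) (c₁ := c₁) hpos) (((WL2.equiv ℂ (fun _ : Bond d (towerP L m (n + 1)) => c₀) W)).symm g))) x :=
    ⟨(WL2.linearEquiv ℂ ℂ (fun _ : TSite d (towerP L m (n + 1)) => c₀)).toLinearMap ∘ₗ
      covDivL2K ℂ c₀ ((η : ℂ))⁻¹ (adTransportW φ fun bb => (U bb)⁻¹) ∘ₗ (G1k L m n φ η U hL αU hα1 hU1 hreg τ (c₀ := c₀) (c₁ := c₁) hpos) ∘ₗ
      (WL2.linearEquiv ℂ ℂ (fun _ : Bond d (towerP L m (n + 1)) => c₀)).symm.toLinearMap, fun _ _ => rfl⟩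
  have hlocD : ∀ (v : TSite d m) (g : Bond d (towerP L m (n + 1)) → W) (F : ℝ),
      (∀ b, blockCoord (L ^ (n + 1)) m (siteCast (towerP_eq_fineP_pow L m (n + 1)) (bpos b)) ≠ v → g b = 0) → (∀ b, ‖g b‖ ≤ F) →
      ∀ x, ‖TD g x‖ ≤ BD * Real.exp (-(δD * tdist m (blockCoord (L ^ (n + 1)) m (siteCast (towerP_eq_fineP_pow L m (n + 1)) x)) v)) * F := by
    intro v g F hgv hgF x
    rw [hTD]
    exact HD n η hηL c₀ c₁ hw hρ m hm U αU hα0 hα1 hU1 hreg εU hεU hUε hLb α hα hαle hUst hUb hUη hpl hUgrad hRlev hεg hAQ hpos' hpos v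
      (((WL2.equiv ℂ (fun _ : Bond d (towerP L m (n + 1)) => c₀) W)).symm g) F (fun b hb => by rw [Equiv.apply_symm_apply]; exact hgv b hb)
      (fun b => by rw [Equiv.apply_symm_apply]; exact hgF b) x
  have hD := norm_apply_le_of_local (fun b : Bond d (towerP L m (n + 1)) => blockCoord (L ^ (n + 1)) m (siteCast (towerP_eq_fineP_pow L m (n + 1)) (bpos b)))
    (fun x : TSite d (towerP L m (n + 1)) => blockCoord (L ^ (n + 1)) m (siteCast (towerP_eq_fineP_pow L m (n + 1)) x))
    (tdist m) TD hBD hlocD (fun u => torusSum_le d hm hδD u) (WL2.equiv ℂ (fun _ : Bond d (towerP L m (n + 1)) => c₀) W f) hM0 hfM y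
  rw [hTD, Equiv.symm_apply_apply] at hD
  exact hD

end Literature.MathematicalPhysics.QuantumFieldTheory.Balaban1983to89.B9Eq347G1kDivergenceGlobal

end
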